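import Summits.Langlands.Langlands.Theorems.IrreducibilityBySelfDualityReciprocityUpToIrreducibilityWeakExistenceNormTwist
import Literature.NumberTheory.Automorphic.BaseChangeStrongUnramifiedRankOne
import HarnessLib

/-!
# Stub N15-G of line `Sketch` (crux `ReciprocityUpToIrreducibility`, item stmt-Langlands-14328) in rank
# one: the Satake clause of the twisted pair `(π, r ⊗ ε_ℓ^k)`, POINTWISE at every `v ∤ ℓ`

Support file (closes nothing).  The accepted `…WeakExistenceAll` (wave N10-F,
`weakExistence_rankOne_of_isFiniteOrder_normTwist_all`) proves, for a cuspidal automorphic datum `π`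
of `GL_1(𝔸_K)` transforming by `(χ₀‖·‖^k) ∘ det`, that the twist `r ⊗ ε_ℓ^k` of the `ℓ`-adic avatar
`r` of `χ₀` by the `k`-th power of the cyclotomic character is Satake–Frobenius compatible with
`(π, ι)` EVENTUALLY (`∀ᶠ v in cofinite`): its `filter_upwards` block runs at the places where `π`
happens to have a Satake parameter.  The assembly of the rank-one sector at ALL places away from `ℓ`
needs the same clause POINTWISE, at every `v ∤ ℓ` where `χ₀` is unramified.  The missing input is
c4's "a `GL_1` datum acted on through `θ ∘ det` HAS a Satake parameter at every place where `θ` is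
unramified" (`AutomorphicRepData.hasSatakeParamAt_glOne_of_isUnramifiedAt`, the engine of the
registered `stub_rankOne_hasSatakeParamAt_of_isUnramifiedAt`): since `‖·‖` is unramified everywhere
(`HeckeCharacter.isUnramifiedAt_normCharacter`), `θ = χ₀‖·‖^k` is unramified at `v` as soon as `χ₀`
is, so `π` has the Satake parameter `{θ(ϖ_v)} = {χ₀(ϖ_v) q_v^{-k}}` at `v`, after which the N10-F
computation applies verbatim: `r ⊗ ε` is unramified at `v` (`FramedGaloisRep.isUnramifiedAt_twist`,
`eq_one_of_mem_inertia_of_cyclotomic_zpow`) with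
`char (r ⊗ ε)(Frob_v^{arith}) = X - q_v^k ι⁻¹(χ₀(ϖ_v))⁻¹`
(`FramedGaloisRep.hasFrobCharpolyAt_twist_of_eq_prod`, `coe_apply_of_isArithFrobAt_of_cyclotomic_zpow`)
`= arithFrobPolyOfSatake ι q_v 1 {χ₀(ϖ_v) q_v^{-k}}` (`arithFrobPolyOfSatake_one`,
`HeckeCharacter.valueAtUniformizer_normCharacter`).

* `isUnramifiedAt_mul_normCharacter_zpow` — `χ₀‖·‖^k` is unramified wherever `χ₀` is;
* `rankOne_satakeFrobCompatibleAt_twist` — the pointwise Satake clause (implicit binders);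
* `stub_rankOne_satake_twist_at` — the closed form registered in the skeleton (wave N15-G).

No definitions; std axioms; no named fact.
(buildfix 2026-08-20: comment-only re-land to re-enqueue the module build after its blocking imports were repaired; no declaration changed.)
-/

noncomputable section

set_option linter.dupNamespace false -- project-wide option (lakefile weak.linter.dupNamespace); `Summit.Langlands.Langlands` is the mandated namespace

open scoped MatrixGroups Matrix NumberField Classical Polynomial
open Filter IsDedekindDomain Field Polynomial
open Literature.NumberTheory.Automorphic Literature.NumberTheory.GaloisRepresentations
open Literature.NumberTheory.PAdicHodge
open Summit.Langlands

namespace Summit.Langlands.Langlands.Theorems.ReciprocityUpToIrreducibility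

variable {K : Type} [Field K] [NumberField K] {ℓ : ℕ} [Fact ℓ.Prime]

/-- **`χ₀‖·‖^k` is unramified wherever `χ₀` is**: the norm character is unramified at every finite
place (`HeckeCharacter.isUnramifiedAt_normCharacter`: the idele norm kills `𝒪_vˣ`), and local
components are multiplicative. [cite: TateThesis1967, §2.3 and Lemma 2.3.1] -/
theorem isUnramifiedAt_mul_normCharacter_zpow {χ₀ : HeckeCharacter K} (k : ℤ)
    {v : HeightOneSpectrum (𝓞 K)} (h : χ₀.IsUnramifiedAt v) :
    (χ₀ * HeckeCharacter.normCharacter K ^ k).IsUnramifiedAt v := fun u => by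
  have h1 := h u
  have h2 := HeckeCharacter.isUnramifiedAt_normCharacter v u
  rw [HeckeCharacter.localComponent_apply] at h1 h2 ⊢
  rw [HeckeCharacter.mul_apply, heckeCharacter_zpow_apply, h1, h2, one_zpow, mul_one]

/-- **The Satake clause of the twisted rank-one pair, pointwise.**  Let the cuspidal automorphic
datum `π` of `GL_1(𝔸_K)` transform by `(χ₀‖·‖^k) ∘ det` (`k ∈ ℤ`), let `r : Γ_K → GL_1(ℚ̄_ℓ)` be
unramified with `char r(Frob_v^{arith}) = X - ι⁻¹(χ₀(ϖ_v))⁻¹` at every place `v` where `χ₀` is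
unramified, and let `ε = ε_ℓ^k`.  Then at EVERY finite place `v ∤ ℓ` where `χ₀` is unramified,
`SatakeFrobCompatibleAt ι π (r ⊗ ε) v` holds, with the Satake parameter `{(χ₀‖·‖^k)(ϖ_v)}`:
`χ₀‖·‖^k` is unramified at `v` (`isUnramifiedAt_mul_normCharacter_zpow`), so this IS
a Satake parameter of `π` at `v` (`AutomorphicRepData.hasSatakeParamAt_glOne_of_isUnramifiedAt`);
`(χ₀‖·‖^k)(ϖ_v) = χ₀(ϖ_v) q_v^{-k}` (`HeckeCharacter.valueAtUniformizer_normCharacter`); `r ⊗ ε` is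
unramified at `v` (`FramedGaloisRep.isUnramifiedAt_twist`, `ε` kills inertia at `v ∤ ℓ`) and
`char (r ⊗ ε)(Frob_v^{arith}) = X - q_v^k ι⁻¹(χ₀(ϖ_v))⁻¹`
(`FramedGaloisRep.hasFrobCharpolyAt_twist_of_eq_prod`, `ε(Frob_v^{arith}) = q_v^k`), which is
`arithFrobPolyOfSatake ι q_v 1 {χ₀(ϖ_v) q_v^{-k}}` (`arithFrobPolyOfSatake_one`).  The
`filter_upwards` block of `weakExistence_rankOne_of_isFiniteOrder_normTwist_all`, read at one place.
[cite: BuzzardGeeLMS2014, Conj. 3.2.1 and Rem. 3.2.5 (n = 1)] [cite: SerreAbelianLadic1968, Ch. I §1.2]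
[cite: BorelJacquet1979, 4.6] -/
theorem rankOne_satakeFrobCompatibleAt_twist (hcpt : isCompact_glFiniteIntegralLevel 1 K)
    (π : CuspidalAutomorphicRepData 1 K hcpt) {χ₀ : HeckeCharacter K} {k : ℤ}
    (hχ : ∀ (g : (AdelicGroupData.gl 1 K).Adelic), ∀ φ ∈ π.1.W,
      rightTranslation (AdelicGroupData.gl 1 K) g φ -
        (((χ₀ * HeckeCharacter.normCharacter K ^ k) (Matrix.GeneralLinearGroup.det g) : ℂˣ) : ℂ) • φ ∈
          π.1.W')
    (ι : PadicAlgCl ℓ ≃+* ℂ) {r : FramedGaloisRep K (PadicAlgCl ℓ) 1}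
    (hr : ∀ v : HeightOneSpectrum (𝓞 K), χ₀.IsUnramifiedAt v →
      r.IsUnramifiedAt v ∧ r.HasFrobCharpolyAt v (X - C (ι.symm (χ₀.valueAtUniformizer v)⁻¹)))
    {ε : absoluteGaloisGroup K →ₜ* (PadicAlgCl ℓ)ˣ}
    (hε : ∀ σ, (ε σ : PadicAlgCl ℓ) =
      (algebraMap ℚ_[ℓ] (PadicAlgCl ℓ) ((GaloisRep.cyclotomicCharacter K ℓ σ : ℤ_[ℓ]ˣ) : ℤ_[ℓ])) ^ k)
    {v : HeightOneSpectrum (𝓞 K)} (hvℓ : ((ℓ : ℕ) : 𝓞 K) ∉ v.asIdeal) (hur₀ : χ₀.IsUnramifiedAt v) :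
    SatakeFrobCompatibleAt ι π.1 (r.twist ε) v := by
  classical
  -- `χ₀‖·‖^k` is unramified at `v`, so `{(χ₀‖·‖^k)(ϖ_v)}` is a Satake parameter of `π` at `v`
  have hur : (χ₀ * HeckeCharacter.normCharacter K ^ k).IsUnramifiedAt v :=
    isUnramifiedAt_mul_normCharacter_zpow k hur₀
  have hϖ := HeckeCharacter.valued_uniformizer (K := K) v
  have hα := π.1.hasSatakeParamAt_glOne_of_isUnramifiedAt hχ hur hϖ
  refine ⟨_, hα, FramedGaloisRep.isUnramifiedAt_twist (hr v hur₀).1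
    (fun 𝔓 h𝔓 σ hσ => eq_one_of_mem_inertia_of_cyclotomic_zpow hε hvℓ h𝔓 hσ), ?_⟩
  -- `(χ₀‖·‖^k)(ϖ_v) = χ₀(ϖ_v) · q_v^{-k}`
  have hval : (((χ₀ * HeckeCharacter.normCharacter K ^ k)
      (localUnits v (HeckeCharacter.uniformizer K v)) : ℂˣ) : ℂ) =
        χ₀.valueAtUniformizer v * ((v.residueCard : ℂ)⁻¹) ^ k := by
    rw [HeckeCharacter.mul_apply, Units.val_mul, heckeCharacter_zpow_apply,
      Units.val_zpow_eq_zpow_val, ← HeckeCharacter.localComponent_apply,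
      ← HeckeCharacter.localComponent_apply,
      HeckeCharacter.localComponent_eq_valueAtUniformizer hur₀ hϖ,
      HeckeCharacter.localComponent_eq_valueAtUniformizer
        (HeckeCharacter.isUnramifiedAt_normCharacter v) hϖ,
      HeckeCharacter.valueAtUniformizer_normCharacter]
  rw [arithFrobPolyOfSatake_one, Multiset.map_singleton, Multiset.prod_singleton, hval]
  have hroot : ι.symm (χ₀.valueAtUniformizer v * ((v.residueCard : ℂ)⁻¹) ^ k)⁻¹ =
      (v.residueCard : PadicAlgCl ℓ) ^ k * ι.symm (χ₀.valueAtUniformizer v)⁻¹ := by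
    rw [mul_inv, inv_zpow, inv_inv, map_mul, map_zpow₀, map_natCast, mul_comm]
  -- the Frobenius characteristic polynomial of `r ⊗ ε` at `v`
  have h0 : r.HasFrobCharpolyAt v
      (({ι.symm (χ₀.valueAtUniformizer v)⁻¹} : Multiset (PadicAlgCl ℓ)).map fun b => X - C b).prod := by
    rw [Multiset.map_singleton, Multiset.prod_singleton]
    exact (hr v hur₀).2
  have htw := FramedGaloisRep.hasFrobCharpolyAt_twist_of_eq_prod h0 (χ := ε)
    (c := (v.residueCard : PadicAlgCl ℓ) ^ k)
    (fun 𝔓 h𝔓 σ hσ => coe_apply_of_isArithFrobAt_of_cyclotomic_zpow hε hvℓ h𝔓 hσ)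
  rw [Multiset.map_singleton, Multiset.prod_singleton] at htw
  rw [hroot]
  exact htw

/-- **Registered stub N15-G `stub_rankOne_satake_twist_at` of line `Sketch` (crux stmt-Langlands-14328),
closed form of `rankOne_satakeFrobCompatibleAt_twist`** (all binders explicit, in the order
`K, ℓ, hcpt, π, χ₀, k, hχ, ι, r, hr, ε, hε, v`).  Let the cuspidal `π` of `GL₁(𝔸_K)` transform by
`(χ₀‖·‖^k) ∘ det`, let `r : Γ_K → GL₁(ℚ̄_ℓ)` carry the Frobenius data of `χ₀` (unramified wherever
`χ₀` is, `char r(Frob_v^{arith}) = X - ι⁻¹(χ₀(ϖ_v))⁻¹` there) and `ε = ε_ℓ^k`.  Then at EVERY place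
`v ∤ ℓ` where `χ₀` is unramified, `SatakeFrobCompatibleAt ι π (r ⊗ ε) v`.
[cite: BuzzardGeeLMS2014, Conj. 3.2.1 and Rem. 3.2.5 (n = 1)] [cite: SerreAbelianLadic1968, Ch. I §1.2]
[cite: BorelJacquet1979, 4.6] -/
theorem stub_rankOne_satake_twist_at :
    ∀ (K : Type) [Field K] [NumberField K] (ℓ : ℕ) [Fact ℓ.Prime]
      (hcpt : isCompact_glFiniteIntegralLevel 1 K) (π : CuspidalAutomorphicRepData 1 K hcpt)
      (χ₀ : HeckeCharacter K) (k : ℤ),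
      (∀ (g : (AdelicGroupData.gl 1 K).Adelic), ∀ φ ∈ π.1.W,
        rightTranslation (AdelicGroupData.gl 1 K) g φ -
          (((χ₀ * HeckeCharacter.normCharacter K ^ k) (Matrix.GeneralLinearGroup.det g) : ℂˣ) : ℂ) • φ ∈
            π.1.W') →
      ∀ (ι : PadicAlgCl ℓ ≃+* ℂ) (r : FramedGaloisRep K (PadicAlgCl ℓ) 1),
      (∀ v : HeightOneSpectrum (𝓞 K), χ₀.IsUnramifiedAt v →
        r.IsUnramifiedAt v ∧ r.HasFrobCharpolyAt v (X - C (ι.symm (χ₀.valueAtUniformizer v)⁻¹))) →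
      ∀ (ε : Field.absoluteGaloisGroup K →ₜ* (PadicAlgCl ℓ)ˣ),
      (∀ σ, (ε σ : PadicAlgCl ℓ) =
        (algebraMap ℚ_[ℓ] (PadicAlgCl ℓ) ((GaloisRep.cyclotomicCharacter K ℓ σ : ℤ_[ℓ]ˣ) : ℤ_[ℓ])) ^ k) →
      ∀ v : HeightOneSpectrum (𝓞 K), ((ℓ : ℕ) : 𝓞 K) ∉ v.asIdeal → χ₀.IsUnramifiedAt v →
        SatakeFrobCompatibleAt ι π.1 (r.twist ε) v :=
  fun _ _ _ _ _ hcpt π _ _ hχ ι _ hr _ hε _ hvℓ hur₀ =>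
    rankOne_satakeFrobCompatibleAt_twist hcpt π hχ ι hr hε hvℓ hur₀

end Summit.Langlands.Langlands.Theorems.ReciprocityUpToIrreducibility

end
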